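import Mathlib

/-!
# Low-density assembly, deterministic part — aux for stub `stub_lowDensityAssembly` of line `Sketch`,
crux stmt-PneNP-2463 (`SolvableImpliesStableSection`)

Deterministic ingredients of the assembly of the low-density block:

* `lds_lexMin_exists`: there is a map `g` sending every satisfiable `k`-CNF instance
  `Φ : Fin m → Fin k → Fin n × Bool` to its `toLex`-least satisfying assignment;
* `lds_sat_of_hall`: Hall's condition (every set `T` of clauses uses at least `#T` variables) gives a
  system of distinct representative variables, hence a satisfying assignment;
* `lds_splice_agree`: consecutive splice instances `P r q`, `P r (q+1)` of the Bresler–Huang path differ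
  only in clause `q / k`;
* `lds_stable` (principal): on a path tuple `Ψ` whose two consecutive splice instances satisfy Hall and whose
  pooled clause-sharing components (segment `r`) have `< u` clauses, the lex-least solutions of the two
  splice instances are at Hamming distance `≤ 2ku` — from the locality statement `hLoc` (a hypothesis here,
  it is another stub of the line) applied to the component of the modified clause.
-/

set_option linter.dupNamespace false

namespace Summit.PneNP.PneNP.Cruxes.SolvableImpliesStableSection.Sketch

open Finset
open scoped Classical

/-- There is a map `g` which sends every satisfiable instance to a satisfying assignment that is
`toLex`-least among all satisfying assignments (and unsatisfiable instances anywhere). -/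
theorem lds_lexMin_exists (k m n : ℕ) :
    ∃ g : (Fin m → Fin k → Fin n × Bool) → (Fin n → Bool),
      ∀ Φ : Fin m → Fin k → Fin n × Bool,
        (∃ σ : Fin n → Bool, ∀ i, ∃ j, σ (Φ i j).1 = (Φ i j).2) →
        (∀ i, ∃ j, g Φ (Φ i j).1 = (Φ i j).2) ∧
        ∀ z : Fin n → Bool, (∀ i, ∃ j, z (Φ i j).1 = (Φ i j).2) → toLex (g Φ) ≤ toLex z := by
  have key : ∀ Φ : Fin m → Fin k → Fin n × Bool, ∃ x : Fin n → Bool,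
      (∃ σ : Fin n → Bool, ∀ i, ∃ j, σ (Φ i j).1 = (Φ i j).2) →
        (∀ i, ∃ j, x (Φ i j).1 = (Φ i j).2) ∧
        ∀ z : Fin n → Bool, (∀ i, ∃ j, z (Φ i j).1 = (Φ i j).2) → toLex x ≤ toLex z := by
    intro Φ
    by_cases h : ∃ σ : Fin n → Bool, ∀ i, ∃ j, σ (Φ i j).1 = (Φ i j).2
    · obtain ⟨σ, hσ⟩ := h
      obtain ⟨x, hx, hmin⟩ := Finset.exists_min_image
        (Finset.univ.filter fun z : Fin n → Bool => ∀ i, ∃ j, z (Φ i j).1 = (Φ i j).2)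
        (fun z => toLex z) ⟨σ, by simpa using hσ⟩
      refine ⟨x, fun _ => ⟨(Finset.mem_filter.1 hx).2, fun z hz => hmin z ?_⟩⟩
      simpa using hz
    · exact ⟨fun _ => false, fun h' => absurd h' h⟩
  choose g hg using key
  exact ⟨g, hg⟩

/-- Hall's condition for the clause/variable incidence of an instance `Φ` (every set `T` of clauses
meets at least `#T` distinct variables) implies that `Φ` is satisfiable: choose an injective system of
representative variables `rep i ∈ vars(clause i)` and set each `rep i` so that it satisfies clause `i`. -/
theorem lds_sat_of_hall (k m n : ℕ) (Φ : Fin m → Fin k → Fin n × Bool)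
    (hH : ∀ T : Finset (Fin m), T.card ≤
      (T.biUnion fun i => Finset.univ.image fun j : Fin k => (Φ i j).1).card) :
    ∃ σ : Fin n → Bool, ∀ i, ∃ j, σ (Φ i j).1 = (Φ i j).2 := by
  obtain ⟨rep, hinj, hmem⟩ :=
    (Finset.all_card_le_biUnion_card_iff_exists_injective
      (fun i : Fin m => Finset.univ.image fun j : Fin k => (Φ i j).1)).1 hH
  have hj : ∀ i, ∃ j, (Φ i j).1 = rep i := fun i => by
    simpa [Finset.mem_image] using hmem i
  choose jr hjr using hj
  refine ⟨fun v => if h : ∃ i, rep i = v then (Φ h.choose (jr h.choose)).2 else false,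
    fun i => ⟨jr i, ?_⟩⟩
  have hex : ∃ i', rep i' = (Φ i (jr i)).1 := ⟨i, (hjr i).symm⟩
  have hci : hex.choose = i := hinj (by rw [hex.choose_spec, hjr])
  show (if h : ∃ i', rep i' = (Φ i (jr i)).1 then (Φ h.choose (jr h.choose)).2 else false) = _
  rw [dif_pos hex, hci]

/-- Consecutive splice instances differ only in clause `q / k`: for a clause index `i ≠ q / k` the
conditions `i*k + b < q + 1` and `i*k + b < q` agree for every literal position `b < k`. -/
theorem lds_splice_agree {X : Type*} (k m : ℕ) (F G : Fin m → Fin k → X) (q : ℕ) (i : Fin m)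
    (hi : (i : ℕ) ≠ q / k) :
    (fun b : Fin k => if (i : ℕ) * k + (b : ℕ) < q + 1 then F i b else G i b) =
      (fun b : Fin k => if (i : ℕ) * k + (b : ℕ) < q then F i b else G i b) := by
  funext b
  have hb := b.isLt
  have hk : 0 < k := lt_of_le_of_lt (Nat.zero_le _) hb
  have hne : (i : ℕ) * k + b ≠ q := by
    intro h
    apply hi
    rw [← h, Nat.add_comm, Nat.add_mul_div_right _ _ hk, Nat.div_eq_of_lt hb, Nat.zero_add]
  have hiff : ((i : ℕ) * k + b < q + 1) ↔ ((i : ℕ) * k + b < q) := by omega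
  simp only [hiff]

/-- Every variable of clause `i` of a splice instance lies in the pool of clause `i` (the variables of
clause `i` in `Ψ (r.castSucc)` and in `Ψ (r.succ)`). -/
theorem lds_pool_mem (k m n : ℕ) (Ψ : Fin (k + 1) → Fin m → Fin k → Fin n × Bool) (r : Fin k)
    (q : ℕ) (i : Fin m) (j : Fin k) :
    (if (i : ℕ) * k + j < q then Ψ r.succ i j else Ψ r.castSucc i j).1 ∈
      (Finset.univ.image fun j : Fin k => (Ψ r.castSucc i j).1) ∪
        (Finset.univ.image fun j : Fin k => (Ψ r.succ i j).1) := by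
  rw [Finset.mem_union]
  by_cases hc : (i : ℕ) * k + j < q
  · rw [if_pos hc]
    exact Or.inr (Finset.mem_image_of_mem (fun j : Fin k => (Ψ r.succ i j).1) (Finset.mem_univ j))
  · rw [if_neg hc]
    exact Or.inl (Finset.mem_image_of_mem (fun j : Fin k => (Ψ r.castSucc i j).1)
      (Finset.mem_univ j))

/-- If a variable of clause `i` of a splice instance lies in the pool of clause `i'`, then `i'` and `i`
are adjacent in the clause-sharing relation of the pooled pair `(Ψ (r.castSucc), Ψ (r.succ))`. -/
theorem lds_adj_of_pool (k m n : ℕ) (Ψ : Fin (k + 1) → Fin m → Fin k → Fin n × Bool) (r : Fin k)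
    (q : ℕ) (i i' : Fin m) (j : Fin k)
    (hv : (if (i : ℕ) * k + j < q then Ψ r.succ i j else Ψ r.castSucc i j).1 ∈
      (Finset.univ.image fun j : Fin k => (Ψ r.castSucc i' j).1) ∪
        (Finset.univ.image fun j : Fin k => (Ψ r.succ i' j).1)) :
    ∃ j j' : Fin k, ∃ ρ ρ' : Fin (k + 1),
      (ρ = r.castSucc ∨ ρ = r.succ) ∧ (ρ' = r.castSucc ∨ ρ' = r.succ) ∧
      (Ψ ρ i' j).1 = (Ψ ρ' i j').1 := by
  rcases Finset.mem_union.1 hv with h | h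
  · obtain ⟨j', -, hj'⟩ := Finset.mem_image.1 h
    by_cases hc : (i : ℕ) * k + j < q
    · rw [if_pos hc] at hj'
      exact ⟨j', j, r.castSucc, r.succ, Or.inl rfl, Or.inr rfl, hj'⟩
    · rw [if_neg hc] at hj'
      exact ⟨j', j, r.castSucc, r.castSucc, Or.inl rfl, Or.inl rfl, hj'⟩
  · obtain ⟨j', -, hj'⟩ := Finset.mem_image.1 h
    by_cases hc : (i : ℕ) * k + j < q
    · rw [if_pos hc] at hj'
      exact ⟨j', j, r.succ, r.succ, Or.inr rfl, Or.inr rfl, hj'⟩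
    · rw [if_neg hc] at hj'
      exact ⟨j', j, r.succ, r.castSucc, Or.inr rfl, Or.inl rfl, hj'⟩

/-- The pool of a clause has at most `2k` variables. -/
theorem lds_pool_card (k m n : ℕ) (Ψ : Fin (k + 1) → Fin m → Fin k → Fin n × Bool) (r : Fin k)
    (i : Fin m) :
    ((Finset.univ.image fun j : Fin k => (Ψ r.castSucc i j).1) ∪
        (Finset.univ.image fun j : Fin k => (Ψ r.succ i j).1)).card ≤ 2 * k := by
  refine (Finset.card_union_le _ _).trans ?_
  have h1 := Finset.card_image_le (s := (Finset.univ : Finset (Fin k)))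
    (f := fun j : Fin k => (Ψ r.castSucc i j).1)
  have h2 := Finset.card_image_le (s := (Finset.univ : Finset (Fin k)))
    (f := fun j : Fin k => (Ψ r.succ i j).1)
  rw [Finset.card_univ, Fintype.card_fin] at h1 h2
  omega

/-- A satisfying assignment violates no clause: the set of violated clauses is empty, so its
cardinality is `≤ ν m` for every `ν ≥ 0`. -/
theorem lds_viol_le (k m n : ℕ) (ν : ℝ) (hν : 0 ≤ ν) (Φ : Fin m → Fin k → Fin n × Bool)
    (x : Fin n → Bool) (hx : ∀ i, ∃ j, x (Φ i j).1 = (Φ i j).2) :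
    ((Finset.univ.filter fun i : Fin m => ∀ j, x (Φ i j).1 ≠ (Φ i j).2).card : ℝ) ≤ ν * m := by
  have h0 : (Finset.univ.filter fun i : Fin m => ∀ j, x (Φ i j).1 ≠ (Φ i j).2) = ∅ := by
    refine Finset.filter_eq_empty_iff.2 ?_
    intro i _ hall
    obtain ⟨j, hj⟩ := hx i
    exact hall j hj
  rw [h0, Finset.card_empty, Nat.cast_zero]
  positivity

/-- **Stability on good paths (principal lemma of this file).** Let `g` pick lex-least solutions (`hg`),
let `hLoc` be the locality statement, and let `Ψ` be a path tuple such that the splice instances at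
positions `q` and `q + 1` of segment `r` both satisfy Hall's condition and every clause-sharing component
of the pooled pair `(Ψ (r.castSucc), Ψ (r.succ))` has `< u` clauses. Then the two lex-least solutions are
at Hamming distance `≤ 2ku`: they agree outside the pooled variables `W` of the component `S` of the
modified clause `q / k` (`hLoc`), and `#W ≤ 2k · #S ≤ 2ku`. -/
theorem lds_stable (k m n : ℕ)
    (hLoc : ∀ (k m n : ℕ) (Φ Φ' : Fin m → Fin k → Fin n × Bool) (a : Fin m)
      (Scl : Finset (Fin m)) (W : Finset (Fin n)),
      (∀ i, i ≠ a → Φ' i = Φ i) → a ∈ Scl →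
      (∀ i ∈ Scl, ∀ j, (Φ i j).1 ∈ W ∧ (Φ' i j).1 ∈ W) →
      (∀ i ∉ Scl, ∀ j, (Φ i j).1 ∉ W) →
      ∀ (x y : Fin n → Bool),
      ((∀ i, ∃ j, x (Φ i j).1 = (Φ i j).2) ∧
        ∀ z : Fin n → Bool, (∀ i, ∃ j, z (Φ i j).1 = (Φ i j).2) → toLex x ≤ toLex z) →
      ((∀ i, ∃ j, y (Φ' i j).1 = (Φ' i j).2) ∧
        ∀ z : Fin n → Bool, (∀ i, ∃ j, z (Φ' i j).1 = (Φ' i j).2) → toLex y ≤ toLex z) →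
      hammingDist x y ≤ W.card)
    (g : (Fin m → Fin k → Fin n × Bool) → (Fin n → Bool))
    (hg : ∀ Φ : Fin m → Fin k → Fin n × Bool,
      (∃ σ : Fin n → Bool, ∀ i, ∃ j, σ (Φ i j).1 = (Φ i j).2) →
        (∀ i, ∃ j, g Φ (Φ i j).1 = (Φ i j).2) ∧
        ∀ z : Fin n → Bool, (∀ i, ∃ j, z (Φ i j).1 = (Φ i j).2) → toLex (g Φ) ≤ toLex z)
    (Ψ : Fin (k + 1) → Fin m → Fin k → Fin n × Bool) (r : Fin k) (q : ℕ) (hq : q < m * k)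
    (hH0 : ∀ T : Finset (Fin m), T.card ≤ (T.biUnion fun i => Finset.univ.image fun j : Fin k =>
        (if (i : ℕ) * k + j < q then Ψ r.succ i j else Ψ r.castSucc i j).1).card)
    (hH1 : ∀ T : Finset (Fin m), T.card ≤ (T.biUnion fun i => Finset.univ.image fun j : Fin k =>
        (if (i : ℕ) * k + j < q + 1 then Ψ r.succ i j else Ψ r.castSucc i j).1).card)
    (u : ℕ) (hS : ∀ a : Fin m, (Finset.univ.filter fun a' : Fin m => Relation.ReflTransGen
        (fun a a' : Fin m => ∃ j j' : Fin k, ∃ ρ ρ' : Fin (k + 1),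
          (ρ = r.castSucc ∨ ρ = r.succ) ∧ (ρ' = r.castSucc ∨ ρ' = r.succ) ∧
          (Ψ ρ a j).1 = (Ψ ρ' a' j').1) a a').card < u) :
    hammingDist (g fun a b => if (a : ℕ) * k + b < q then Ψ r.succ a b else Ψ r.castSucc a b)
      (g fun a b => if (a : ℕ) * k + b < q + 1 then Ψ r.succ a b else Ψ r.castSucc a b)
      ≤ 2 * k * u := by
  have hk : 0 < k := Nat.pos_of_ne_zero (by rintro rfl; simp at hq)
  -- the modified clause, the clause-sharing relation, its component and the pooled variables
  set a : Fin m := ⟨q / k, (Nat.div_lt_iff_lt_mul hk).2 hq⟩ with ha_def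
  set Φ : Fin m → Fin k → Fin n × Bool :=
    fun a b => if (a : ℕ) * k + b < q then Ψ r.succ a b else Ψ r.castSucc a b with hΦ
  set Φ' : Fin m → Fin k → Fin n × Bool :=
    fun a b => if (a : ℕ) * k + b < q + 1 then Ψ r.succ a b else Ψ r.castSucc a b with hΦ'
  set Adj : Fin m → Fin m → Prop := fun a a' : Fin m => ∃ j j' : Fin k, ∃ ρ ρ' : Fin (k + 1),
    (ρ = r.castSucc ∨ ρ = r.succ) ∧ (ρ' = r.castSucc ∨ ρ' = r.succ) ∧
    (Ψ ρ a j).1 = (Ψ ρ' a' j').1 with hAdj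
  set S : Finset (Fin m) := Finset.univ.filter fun a' : Fin m => Relation.ReflTransGen Adj a a'
    with hS_def
  set pool : Fin m → Finset (Fin n) := fun i =>
    (Finset.univ.image fun j : Fin k => (Ψ r.castSucc i j).1) ∪
      (Finset.univ.image fun j : Fin k => (Ψ r.succ i j).1) with hpool
  set W : Finset (Fin n) := S.biUnion pool with hW
  -- the two lex-least solutions
  have hx := hg Φ (lds_sat_of_hall k m n Φ hH0)
  have hy := hg Φ' (lds_sat_of_hall k m n Φ' hH1)
  -- hypotheses of the locality statement
  have hagree : ∀ i, i ≠ a → Φ' i = Φ i := by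
    intro i hi
    have hi' : (i : ℕ) ≠ q / k := fun h => hi (Fin.ext h)
    exact lds_splice_agree k m (fun a b => Ψ r.succ a b) (fun a b => Ψ r.castSucc a b) q i hi'
  have ha : a ∈ S := by
    simp only [hS_def, Finset.mem_filter, Finset.mem_univ, true_and]
    exact Relation.ReflTransGen.refl
  have hin : ∀ i ∈ S, ∀ j, (Φ i j).1 ∈ W ∧ (Φ' i j).1 ∈ W := by
    intro i hi j
    exact ⟨Finset.mem_biUnion.2 ⟨i, hi, lds_pool_mem k m n Ψ r q i j⟩,
      Finset.mem_biUnion.2 ⟨i, hi, lds_pool_mem k m n Ψ r (q + 1) i j⟩⟩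
  have hout : ∀ i ∉ S, ∀ j, (Φ i j).1 ∉ W := by
    intro i hi j hmem
    obtain ⟨i', hi', hv⟩ := Finset.mem_biUnion.1 hmem
    apply hi
    simp only [hS_def, Finset.mem_filter, Finset.mem_univ, true_and] at hi' ⊢
    exact hi'.tail (lds_adj_of_pool k m n Ψ r q i i' j hv)
  have hdist := hLoc k m n Φ Φ' a S W hagree ha hin hout (g Φ) (g Φ') hx hy
  -- size of the pooled variable set
  have hWcard : W.card ≤ S.card * (2 * k) :=
    Finset.card_biUnion_le_card_mul S pool (2 * k) (fun i _ => lds_pool_card k m n Ψ r i)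
  have hSu : S.card ≤ u := (hS a).le
  calc hammingDist (g Φ) (g Φ') ≤ W.card := hdist
    _ ≤ S.card * (2 * k) := hWcard
    _ ≤ u * (2 * k) := Nat.mul_le_mul_right _ hSu
    _ = 2 * k * u := by ring

end Summit.PneNP.PneNP.Cruxes.SolvableImpliesStableSection.Sketch
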